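import Summits.BirchSwinnertonDyer.BirchSwinnertonDyer.Theorems.EisensteinPrimesBSDpOnCellCOfNamedFactsV8
import Summits.BirchSwinnertonDyer.BirchSwinnertonDyer.Theorems.SchneiderFreeAdditiveX3EndStateControlDischarged
import Summits.BirchSwinnertonDyer.BirchSwinnertonDyer.Theorems.PrintCf2SplitBadTwoRankOneOfFactsPrintsTwoOfThree
import Literature.NumberTheory.IwasawaTheory.Greenberg2006.LocalH2VanishingOfLOC1
import HarnessLib

/-!
# Crux 4 `BSDpOnCellC` (stmt-BirchSwinnertonDyer-19034), line «crystal» v8: THREE of the 29 conjuncts of the registered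
# `stub_publishedFacts` are TREE THEOREMS — the two Poitou–Tate dualities `∀ K, poitouTate_selmerStructure_duality K`,
# `∀ K, poitouTate_sha_tateDual K` (Milne ADT I Thm. 4.10, re-proved in the tree by the Schneider-free additive X3 lane) and
# Greenberg 2006 §5 A `sec5A_localH2_subsingleton_of_LOC1` (local Tate duality in the limit, proved in Literature) — so the stub
# can shrink 29 → 26 BY NAME: `publishedFactsV8_of_drop3 : <v8 text minus those three> → <v8 text token for token>`
# (cell `bsd-eis`, width seat `bsd-line-x2-p2` g13; `--supports stmt-BirchSwinnertonDyer-19034`; the skeleton is the LEAD's and is NOT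
# touched here — W-79)

WHAT THIS GIVES THE LEAD. For a v10 with `stub_publishedFacts := <the 26-conjunct text below>` the composition of record stays a one-liner:
`…OfNamedFactsV8.bsdpOnCellC_of_namedFactsV8 (PublishedFactsV8Discharge.publishedFactsV8_of_drop3 stub_publishedFacts) …`. The three
discharges are ALREADY landed, each with EXACTLY the conjunct's type (found by the gate's dedup): `SchneiderFreeAdditiveX3.ControlDischarged.pt_selmer_forall`
(Milne ADT I Thm. 4.10 (b), from `InputsPoitouTateSelmer.poitouTate_selmerStructure_duality_conj_holds`),
`PrintCf2.EisensteinTwo.poitouTate_sha_tateDual_forall` (Thm. 4.10 (a), from `SchneiderFreeAdditiveX3.PoitouTateReduction.poitouTate_sha_tateDual_holds`),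
`Greenberg2006.sec5A_localH2_subsingleton_of_LOC1_holds` (Literature) — this file only re-assembles the conjunction. Nothing else of the 29 is a tree theorem today (x2-p2 g13 audit, 2026-08-29:
the remaining 26 have only CONDITIONAL `_of_` derivations in the tree).

HONEST FRAMING: bookkeeping by name (∧-reassembly); 0 defs, 0 sorry, no new named fact; nothing about any curve is asserted; no summit
statement / BSD / MC / IMC is proved; 0 cells / labels / tiers move; debt −3 in the crux's closure once the LEAD reshapes.

References: [MilneADT2006] Ch. I Thm. 4.10 (a)(b); [Greenberg2006] §5 A; cell `Lines/crystal.lean` v8 (`stub_publishedFacts`).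
-/

set_option autoImplicit false
set_option linter.dupNamespace false

noncomputable section

open scoped Classical MatrixGroups ModularForm

open CongruenceSubgroup WeierstrassCurve NumberField IsDedekindDomain Field PowerSeries
  Literature.NumberTheory.EllipticCurves Literature.NumberTheory.EllipticCurves.GreenbergSelmer
  Literature.NumberTheory.EllipticCurves.ModularForms Literature.NumberTheory.QuadraticFields
  Literature.NumberTheory.EllipticCurves.Rank1Residual
  Literature.NumberTheory.EllipticCurves.Rank1Residual.Typed
  Literature.NumberTheory.EllipticCurves.KrizLi2019
  Literature.NumberTheory.EllipticCurves.GreenbergVatsal2000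
  Literature.NumberTheory.EllipticCurves.Wuthrich2014
  Literature.NumberTheory.EllipticCurves.SteinWuthrich2013
  Literature.NumberTheory.EllipticCurves.Castella2018Exceptional
  Literature.NumberTheory.GaloisRepresentations Literature.NumberTheory.GaloisCohomology
  Literature.NumberTheory.Automorphic
  Summit.BirchSwinnertonDyer.Rank1Residual.X11b.AcSelmer
  Summit.BirchSwinnertonDyer.Rank1Residual.X11b.Halves
  Summit.BirchSwinnertonDyer.Rank1Residual.X11b
  Summit.BirchSwinnertonDyer.Rank1Residual Summit.BirchSwinnertonDyer.Rank1Residual.X1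
  Summit.BirchSwinnertonDyer.Rank1Residual.X2
open Literature.NumberTheory.EllipticCurves.CastellaGrossiLeeSkinner2022 Literature.NumberTheory.EllipticCurves.Castella2018
  Literature.NumberTheory.IwasawaTheory Literature.NumberTheory.IwasawaTheory.Greenberg2016
  Literature.NumberTheory.IwasawaTheory.Greenberg2006
  Summit.BirchSwinnertonDyer.Rank1Residual.X1.KellerYinMuLambdaSplit
open Literature.NumberTheory.EllipticCurves.KellerYin2024

namespace Summit.BirchSwinnertonDyer.BirchSwinnertonDyer.Theorems.PublishedFactsV8Discharge

/-- **`stub_publishedFacts` of crystal v8, ITS REGISTERED TEXT TOKEN FOR TOKEN, from the SAME text with the three tree theorems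
REMOVED** (conjuncts 7, 8 of `.1` — the two Poitou–Tate dualities — and conjunct 3 of `.2` — Greenberg §5 A): the LEAD's by-name shrink
29 → 26. Pure ∧-reassembly. [cite: MilneADT2006, Ch. I, Thm. 4.10] [cite: Greenberg2006, §5 A] -/
theorem publishedFactsV8_of_drop3
    (h : (((lambdaMu_multiplicative_of_gvPar ∧ thm16_charIdeal_dvd_multiplicative_of_reducible ∧
      thm61_splitMultiplicative ∧ thm61_nonsplitMultiplicative ∧
      (∀ (W : WeierstrassCurve ℚ) [W.IsElliptic] [W.IsGloballyMinimal] (p : ℕ) [Fact p.Prime],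
        greenberg_stevens (W := W) (p := p)) ∧
      exists_isNewformOf ∧
      hsieh2014_exists_anticyclotomicPAdicLFunction ∧
      (∀ (N : ℕ) [NeZero N] (W : WeierstrassCurve ℚ) (K : Type) [Field K] [NumberField K],
        gross_zagier N W K) ∧
      (∀ (N : ℕ) [NeZero N] (W : WeierstrassCurve ℚ) (K : Type) [Field K] [NumberField K],
        kolyvagin N W K) ∧
      rank_eq_analyticRank_of_analyticRank_le_one ∧ HoffsteinLuo1997_exists_twist_L_one_ne_zero ∧
      mazur_not_dvd_maninConstant_of_odd ∧ bsdRHS_eq_of_isIsogenous) ∧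
      thm210_thm211_bdpDisplay_pNew) ∧
      LiuZhangZhang2018.thm151_thm153_modularCurve_heegnerVector) ∧
      (prop125_characterGrSelmerDual_torsion_muZero_dim ∧ prop263_sur_of_crk ∧
        cor126_residualCharacter_globalLift ∧ cor126_residualCharacter_localSurjective ∧ prop411_selmer_isAlmostDivisible ∧
        prop41_globalEulerPoincareCorank ∧ prop42_localEulerPoincareCorank ∧ prop32_cohomology_isCofinitelyGenerated ∧
        thm212_exists_isKatzLFunction ∧
        CastellaGrossiLeeSkinner2022.thm122_fe_omegaPartner_charGrDual_torsion_muZero_lambda_eq ∧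
        CastellaGrossiLeeSkinner2022.thm122_charGrDual_torsion_muZero_firstUnit_lambda_eq)) :
    (((lambdaMu_multiplicative_of_gvPar ∧ thm16_charIdeal_dvd_multiplicative_of_reducible ∧
    thm61_splitMultiplicative ∧ thm61_nonsplitMultiplicative ∧
    (∀ (W : WeierstrassCurve ℚ) [W.IsElliptic] [W.IsGloballyMinimal] (p : ℕ) [Fact p.Prime],
      greenberg_stevens (W := W) (p := p)) ∧
    exists_isNewformOf ∧
    (∀ (K : Type) [Field K] [NumberField K], poitouTate_selmerStructure_duality K) ∧
    (∀ (K : Type) [Field K] [NumberField K], poitouTate_sha_tateDual K) ∧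
    hsieh2014_exists_anticyclotomicPAdicLFunction ∧
    (∀ (N : ℕ) [NeZero N] (W : WeierstrassCurve ℚ) (K : Type) [Field K] [NumberField K],
      gross_zagier N W K) ∧
    (∀ (N : ℕ) [NeZero N] (W : WeierstrassCurve ℚ) (K : Type) [Field K] [NumberField K],
      kolyvagin N W K) ∧
    rank_eq_analyticRank_of_analyticRank_le_one ∧ HoffsteinLuo1997_exists_twist_L_one_ne_zero ∧
    mazur_not_dvd_maninConstant_of_odd ∧ bsdRHS_eq_of_isIsogenous) ∧
    thm210_thm211_bdpDisplay_pNew) ∧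
    LiuZhangZhang2018.thm151_thm153_modularCurve_heegnerVector) ∧
    (prop125_characterGrSelmerDual_torsion_muZero_dim ∧ prop263_sur_of_crk ∧ sec5A_localH2_subsingleton_of_LOC1 ∧
      cor126_residualCharacter_globalLift ∧ cor126_residualCharacter_localSurjective ∧ prop411_selmer_isAlmostDivisible ∧
      prop41_globalEulerPoincareCorank ∧ prop42_localEulerPoincareCorank ∧ prop32_cohomology_isCofinitelyGenerated ∧
      thm212_exists_isKatzLFunction ∧
      CastellaGrossiLeeSkinner2022.thm122_fe_omegaPartner_charGrDual_torsion_muZero_lambda_eq ∧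
      CastellaGrossiLeeSkinner2022.thm122_charGrDual_torsion_muZero_firstUnit_lambda_eq) := by
  obtain ⟨⟨⟨⟨h1, h2, h3, h4, h5, h6, h9, h10, h11, h12, h13, h14, h15⟩, h16⟩, h17⟩,
    ⟨g1, g2, g4, g5, g6, g7, g8, g9, g10, g11, g12⟩⟩ := h
  exact ⟨⟨⟨⟨h1, h2, h3, h4, h5, h6, SchneiderFreeAdditiveX3.ControlDischarged.pt_selmer_forall,
    PrintCf2.EisensteinTwo.poitouTate_sha_tateDual_forall, h9, h10, h11, h12, h13, h14, h15⟩, h16⟩, h17⟩,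
    ⟨g1, g2, Greenberg2006.sec5A_localH2_subsingleton_of_LOC1_holds, g4, g5, g6, g7, g8, g9, g10, g11, g12⟩⟩

end Summit.BirchSwinnertonDyer.BirchSwinnertonDyer.Theorems.PublishedFactsV8Discharge

end
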